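import Literature.AnabelianGeometry.AbsoluteAnabelian.MonoidKummerMapsSub
import HarnessLib

/-!
# [AbsTopIII] Prop 3.2 (i) sub-DAG rows P32.i.L06 / L07: the statements `Prop32iChain.H2IsoEq` and
# `Prop32i_indexCompat` are INSTANCE-ONLY schemas (kernel witnesses; proof-only)

Proof-only companion of abc-iut-w4-d045's `MonoidKummerMapsSub.lean` (p413741; S. Mochizuki, *Topics in
Absolute Anabelian Geometry III*, Prop. 3.2 (i) p. 71, Rmk. 3.2.2 p. 73; kurims manuscript, lit key
`paper:url-5493eb38cbb7`).  Seat abc-iut-L6-t13 (RQ7 second pass of p413741 with kernel probes).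

`Prop32iChain T` carries the five printed isomorphisms of the Brauer-group chain over ABSTRACT carriers
(the tree has no `H²` with the printed coefficients), and `H2Pullback φ T T'` carries `H²(φ)` and the
index of Rmk. 3.2.2 as free data.  The two `Prop`-valued rows built on them are therefore consumable
only AT A NAMED INSTANCE (a chain / pull-back constructed from actual cohomology), never as
"`∃` data satisfying the row" — that existential is trivially true — nor as "`∀` data, the row" — that
universal is false as soon as `H²` is non-trivial.  This file records the kernel witnesses:

* `Prop32iChain.exists_h2IsoEq` — from ANY chain `C` one re-gauges the identification
  `Hom(ℚ/ℤ, H²(G, μ_{ℚ/ℤ}(M))) ≅ H²(G, μ_Ẑ(M))` so that `H2IsoEq` holds: the row has no content beyond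
  `Nonempty (Prop32iChain T)`;
* `exists_indexCompat` — for any two Kummer theories and any morphism of pairs there is pull-back DATA
  (map `:= h2Iso⁻¹ ∘ h2Iso'`, index `1`) satisfying `Prop32i_indexCompat`;
* `not_forall_indexCompat` — and pull-back data violating it (index `1`, map `0`) as soon as
  `H²(G*, μ_Ẑ(M*))` has a non-zero element, so the universally quantified form is refutable.

Nothing in `MonoidKummerMapsSub.lean` is contradicted: its docstrings say "Named `Prop` on the data; not
asserted".  The witnesses pin HOW the rows may be consumed (instance-only, R5 of the FACT-LIST rules).
HONEST FRAMING: elementary bookkeeping; nothing here bears on [IUTchIII] Cor. 3.12.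
-/

namespace Literature.AnabelianGeometry.AbsoluteAnabelian

open _root_.CategoryTheory

universe u

noncomputable section

namespace Prop32iChain

variable {P : GaloisMonoidPair.{u}} {T : MonoidKummerTheory P}

/-- **Row P32.i.L06 is instance-only.**  From any chain datum `C` over `T` one obtains a chain datum
(same carriers and same five chain isomorphisms; only the identification
`Hom(ℚ/ℤ, H²(G, μ_{ℚ/ℤ}(M))) ≅ H²(G, μ_Ẑ(M))` re-gauged) for which `H2IsoEq` HOLDS — so "there is a chain
whose composite is `h2Iso`" carries no information beyond the existence of a chain.
[cite: MochizukiAbsTopIII2015, Proposition 3.2 (i) p.71] -/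
theorem exists_h2IsoEq (C : Prop32iChain T) :
    ∃ C' : Prop32iChain T, C'.H2IsoEq ∧ C'.H2muQZ = C.H2muQZ ∧ C'.H2Mgp = C.H2Mgp ∧
      C'.H2unr = C.H2unr ∧ C'.H2unrVal = C.H2unrVal ∧ C'.H2ZhatZ = C.H2ZhatZ := by
  let C' : Prop32iChain T :=
    { C with homQmodZ := (C.homInvariant.trans C.endQmodZ).trans T.h2Iso.symm }
  have hinv : C'.homInvariant = C.homInvariant := rfl
  have hend : C'.endQmodZ = C.endQmodZ := rfl
  have hhom : C'.homQmodZ = (C.homInvariant.trans C.endQmodZ).trans T.h2Iso.symm := rfl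
  refine ⟨C', ?_, rfl, rfl, rfl, rfl, rfl⟩
  show T.h2Iso = C'.h2IsoOfChain
  rw [h2IsoOfChain, hinv, hend, hhom]
  ext x
  simp only [AddEquiv.trans_apply, AddEquiv.symm_trans_apply, AddEquiv.symm_symm,
    AddEquiv.apply_symm_apply]

end Prop32iChain

/-- **Row P32.i.L07 is instance-only (satisfiable side).**  For any Kummer theories `T`, `T'` of pairs
`P`, `Q` and any morphism `φ : P → Q` there is pull-back DATA satisfying `Prop32i_indexCompat`: take
`H²(φ) := h2Iso⁻¹ ∘ h2Iso'` and index `1`. [cite: MochizukiAbsTopIII2015, Remark 3.2.2 p.73] -/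
theorem exists_indexCompat {P Q : GaloisMonoidPair.{u}} (φ : P.Hom Q) (T : MonoidKummerTheory P)
    (T' : MonoidKummerTheory Q) : ∃ B : H2Pullback φ T T', Prop32i_indexCompat B := by
  let B : H2Pullback φ T T' :=
    ⟨(T.h2Iso.symm.toAddMonoidHom).comp T'.h2Iso.toAddMonoidHom, 1, Nat.one_pos⟩
  refine ⟨B, fun x => ?_⟩
  show T.h2Iso (T.h2Iso.symm (T'.h2Iso x)) = 1 • T'.h2Iso x
  rw [AddEquiv.apply_symm_apply, one_smul]

/-- **Row P32.i.L07 is instance-only (refutable side).**  If `H²(G*, μ_Ẑ(M*))` has a non-zero element,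
there is pull-back DATA violating `Prop32i_indexCompat` (map `0`, index `1`): the universally
quantified form "every `H2Pullback` is index-compatible" is false.
[cite: MochizukiAbsTopIII2015, Remark 3.2.2 p.73] -/
theorem not_forall_indexCompat {P Q : GaloisMonoidPair.{u}} (φ : P.Hom Q) (T : MonoidKummerTheory P)
    (T' : MonoidKummerTheory Q) (h : ∃ x : T'.coh.H2, x ≠ 0) :
    ¬ ∀ B : H2Pullback φ T T', Prop32i_indexCompat B := by
  obtain ⟨x, hx⟩ := h
  intro hall
  let B : H2Pullback φ T T' := ⟨0, 1, Nat.one_pos⟩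
  have h1 : T.h2Iso ((0 : T'.coh.H2 →+ T.coh.H2) x) = (1 : ℕ) • T'.h2Iso x := hall B x
  rw [AddMonoidHom.zero_apply, map_zero, one_smul] at h1
  exact hx (T'.h2Iso.injective (by rw [map_zero]; exact h1.symm))

end

end Literature.AnabelianGeometry.AbsoluteAnabelian
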